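import Summits.Ventures.WeilGRH.ZetaGramAtoms
import Summits.RiemannHypothesis.RiemannHypothesis.Theorems.WeilBochnerMeasureWindow
import HarnessLib

/-!
# rh-explicit (venture WeilGRH): THE FORMAT-C GRAM MATRIX IS A MULTIPLICITY CERTIFICATE —
  `μ{τ} · |Σ_n x_n χ̂_n(½+iτ)|² ≤ xᵀ G_a x` for every trigonometric window, at every height

Cell `rh-explicit`, WEIL TRACK (structure seat weil-3, gen9).  `ZetaGramAtoms.lean` used one basis function
(the diagonal entry `G_a(n,n)` bounds the atom at the lattice height `−πn/a`).  With the structure seat's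
`WeilBochnerMeasureWindow.sum_mul_mul_gramCoeff_eq_integral` (gen4: `xᵀ G_a x = ∫ |Σ x_n χ̂_n(½+it)|² dμ` for
real vectors `x`) every TRIGONOMETRIC WINDOW `u = Σ_n x_n χ_n` gives a bound at EVERY height `τ`:

* **`atom_mul_norm_sq_le_gramForm`** (RH-free): for `a > 0`, every positive `μ` representing Weil's form on
  `[-a, a]`, every finite `s ⊆ ℤ`, real `x`, and `τ ∈ ℝ`:
  `μ{τ} · ‖Σ_{n∈s} x_n χ̂_n(½+iτ)‖² ≤ Σ_{n,m∈s} x_n x_m G_a(n,m)`;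
* **`zetaZeroOrder_mul_norm_sq_le_gramForm`**: under RH the same with `μ{τ} = ord_{s=½+iτ} ζ(s)` — the
  multiplicity of ANY zero is at most the generalized Rayleigh quotient `xᵀG_a x / |Σ x_n χ̂_n(ρ)|²` of the
  certified format-C matrix, for every real coefficient vector (optimum `1/(vᵀ G⁻¹ v)`-type, on paper).

No definitions, no named facts; RH only where named.
-/

set_option autoImplicit false

noncomputable section

open Complex Filter Set MeasureTheory
open scoped Real Topology ComplexConjugate

namespace Summit.Ventures.WeilGRH

open Literature.NumberTheory.LFunctions
open Literature.NumberTheory.LFunctions.Yoshida1992 (chi gramCoeff)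
open Literature.NumberTheory.LFunctions.WeilBochner (zetaZeroHeightMeasure)
open Summit.RiemannHypothesis.RiemannHypothesis.Theorems.WeilBochnerMeasure (sum_mul_mul_gramCoeff_eq_integral
  weilWindowForm_sum_smul_chi_eq_integral integrable_inv_one_add_sq)

variable {a : ℝ}

/-- **THE GRAM FORM BOUNDS THE ATOMS AT EVERY HEIGHT** (RH-free).  For `a > 0`, every positive measure `μ`
representing Weil's form on the tests of `[-a, a]`, every finite set of modes `s`, real coefficients `x`
and every `τ ∈ ℝ`:

  `μ{τ} · ‖Σ_{n∈s} x_n χ̂_n(½+iτ)‖² ≤ Σ_{n,m∈s} x_n x_m · gramCoeff a n m`. -/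
theorem atom_mul_norm_sq_le_gramForm (ha : 0 < a) {μ : Measure ℝ}
    (hμ : ∀ g : ℝ → ℂ, IsWeilTest g → tsupport g ⊆ Icc (-a) a →
      Integrable (fun t : ℝ ↦ ‖weilMellin g (1 / 2 + t * I)‖ ^ 2) μ ∧
        weilQuadratic g = ((∫ t, ‖weilMellin g (1 / 2 + t * I)‖ ^ 2 ∂μ : ℝ) : ℂ))
    (s : Finset ℤ) (x : ℤ → ℝ) (τ : ℝ) :
    μ.real {τ} * ‖weilMellin (∑ n ∈ s, (x n : ℂ) • chi a n) (1 / 2 + τ * I)‖ ^ 2 ≤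
      ∑ n ∈ s, ∑ m ∈ s, x n * x m * gramCoeff a n m := by
  set u : ℝ → ℂ := ∑ n ∈ s, (x n : ℂ) • chi a n with hu
  obtain ⟨hint, -⟩ := weilWindowForm_sum_smul_chi_eq_integral ha hμ s (fun n ↦ (x n : ℂ))
  rw [sum_mul_mul_gramCoeff_eq_integral ha hμ s x]
  have hI := integrable_inv_one_add_sq ha hμ
  have h0 := measure_singleton_lt_top_of_integrable hI τ
  set c : ℝ := ‖weilMellin u (1 / 2 + τ * I)‖ ^ 2 with hc
  have hind : Integrable (fun t : ℝ ↦ ({τ} : Set ℝ).indicator (fun _ ↦ c) t) μ :=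
    (integrable_indicator_iff (measurableSet_singleton τ)).2 (integrableOn_const h0.ne)
  have hle : ∀ t : ℝ, ({τ} : Set ℝ).indicator (fun _ ↦ c) t ≤ ‖weilMellin u (1 / 2 + t * I)‖ ^ 2 := by
    intro t
    by_cases ht : t ∈ ({τ} : Set ℝ)
    · rw [indicator_of_mem ht, mem_singleton_iff.1 ht]
    · rw [indicator_of_notMem ht]; positivity
  calc μ.real {τ} * c = ∫ t, ({τ} : Set ℝ).indicator (fun _ ↦ c) t ∂μ := by
        rw [integral_indicator_const _ (measurableSet_singleton τ), smul_eq_mul]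
    _ ≤ ∫ t, ‖weilMellin u (1 / 2 + t * I)‖ ^ 2 ∂μ := integral_mono hind hint hle

/-- **RH ⟹ THE FORMAT-C GRAM MATRIX BOUNDS EVERY MULTIPLICITY**: for `a > 0`, finite `s ⊆ ℤ`, real `x`,
and every height `τ`:
`ord_{s=½+iτ} ζ(s) · ‖Σ_{n∈s} x_n χ̂_n(½+iτ)‖² ≤ Σ_{n,m∈s} x_n x_m · gramCoeff a n m`. -/
theorem zetaZeroOrder_mul_norm_sq_le_gramForm (hRH : RiemannHypothesis) (ha : 0 < a) (s : Finset ℤ)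
    (x : ℤ → ℝ) (τ : ℝ) :
    ((riemannZetaZeroOrder (1 / 2 + τ * I)).toNat : ℝ) *
        ‖weilMellin (∑ n ∈ s, (x n : ℂ) • chi a n) (1 / 2 + τ * I)‖ ^ 2 ≤
      ∑ n ∈ s, ∑ m ∈ s, x n * x m * gramCoeff a n m := by
  have h := atom_mul_norm_sq_le_gramForm ha
    (fun g hg _ ↦ WeilBochner.weilQuadratic_eq_integral_of_riemannHypothesis hRH hg) s x τ
  rwa [measureReal_def, zetaZeroHeightMeasure_singleton_of_riemannHypothesis hRH, ENNReal.toReal_natCast] at h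

end Summit.Ventures.WeilGRH

end
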